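import Summits.ValiantsHypothesis.ValiantsHypothesis.Theses.DivisionGap
import Summits.ValiantsHypothesis.ValiantsHypothesis.Theorems.PerCofactorDegreeReduction.Negative.KillCost

/-!
# `DivisionGap.PerCofactorDegreeReduction` (stmt-ValiantsHypothesis-15046): logical position,
# positive side — the crux is the `h' = 1` corollary of weakly-exponential hardness of all
# monotone multiples, and it LIFTS low-degree hardness to all degrees

The crux `PerCofactorDegreeReduction` (PCDR) reads
`∃ k, ∀ n, ∀ h ≠ 0, ∃ h' ≠ 0, deg h' ≤ B ∧ L⁺(per_n · h') ≤ B`,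
`B = 2 ^ ((log₂ n + log₂ s + k) ^ k)`, `s = L⁺(per_n · h)`, `L⁺ = complexity` over `ℝ≥0`.

Write **ExpMultiplesHard** (window form) for the statement that every nonzero monotone multiple of
the permanent is weakly-exponentially hard,
`∃ k n₀, ∀ n ≥ n₀, ∀ h ≠ 0, n ≤ (log₂ n + log₂ L⁺(per_n · h) + k) ^ k`
(i.e. `L⁺(per_n · h) ≥ 2^{n^{1/k}}` up to the harmless `log₂ n + k` inside), and
**LowDegreeExpHard** for the same statement with `L⁺(per_n · h)` replaced by
`max (deg h) (L⁺(per_n · h))` ("a multiple of LOW cofactor degree is expensive").  Both are stated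
INLINE as hypotheses below (they are conjectures, not facts; no definition is introduced).

* `pcdr_of_expMultiplesHard` — ExpMultiplesHard ⇒ PCDR, with the witness `h' = 1`: the bound `B`
  then exceeds `(n+1)! ≥ L⁺(per_n)` (`complexity_perPoly_le_factorial_succ`).  This is the positive
  form of the disprover's `two_pow_lt_complexity_perPoly_io_of_not_pcdr` (KillCost): the crux is
  EXACTLY as exposed as an exponential lower bound for all monotone multiples of `per_n`
  (Hrubeš–Yehudayoff 2021 §6 Problem 2 / §9 Open Problem 3 for `f = per`, exponential form).
* `expMultiplesHard_of_pcdr_of_lowDegreeExpHard` — PCDR ∧ LowDegreeExpHard ⇒ ExpMultiplesHard: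
  the crux is a hardness-LIFTING statement (from cofactors of degree `< 2^{n^{1/k}}` to all
  cofactors, with quasi-polynomial loss in the exponent `k`).
* `pcdr_iff_expMultiplesHard_of_lowDegreeExpHard` — hence, granted LowDegreeExpHard, the crux is
  EQUIVALENT to ExpMultiplesHard.

These three bookkeeping theorems record, kernel-checked, the logical position found by the line
leads of `Cruxes/PerCofactorDegreeReduction/Lines/Sketch*` (c2–c9): the crux (and its necessary stub
K1W) is crux-sized — any proof is an exponential lower bound for all monotone multiples of the
permanent or a lifting theorem of that strength, any refutation a `2^{o(n)}` monotone multiple.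
-/

noncomputable section

-- `Summit.ValiantsHypothesis.ValiantsHypothesis.…` is the tree's mandated single-conjunct layout.
set_option linter.dupNamespace false

namespace Summit.ValiantsHypothesis.ValiantsHypothesis.Theorems.DivisionGap.PerCofactorDegreeReduction.LogicalPosition

open Literature.Computability.AlgebraicComplexity MvPolynomial
open Summit.ValiantsHypothesis.ValiantsHypothesis.Theses.DivisionGap (PerCofactorDegreeReduction)
open Summit.ValiantsHypothesis.Theorems.PerCofactorDegreeReductionNegative
  (complexity_perPoly_le_factorial_succ qp_mono)
open scoped NNReal

/-! ### Arithmetic -/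

/-- `(n+1)! ≤ 2 ^ ((log₂ n + 1) * (n + 1))`. [folklore] -/
theorem factorial_succ_le_two_pow (n : ℕ) :
    (n + 1).factorial ≤ 2 ^ ((Nat.log 2 n + 1) * (n + 1)) := by
  have h1 : (n + 1).factorial ≤ (n + 1) ^ (n + 1) := Nat.factorial_le_pow (n + 1)
  have h2 : n + 1 ≤ 2 ^ (Nat.log 2 n + 1) := Nat.lt_pow_succ_log_self one_lt_two n
  calc (n + 1).factorial ≤ (n + 1) ^ (n + 1) := h1
    _ ≤ (2 ^ (Nat.log 2 n + 1)) ^ (n + 1) := Nat.pow_le_pow_left h2 _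
    _ = 2 ^ ((Nat.log 2 n + 1) * (n + 1)) := by rw [← pow_mul]

/-- If `n ≤ (log₂ n + a + k) ^ k` with `1 ≤ k` and `k + 1 ≤ K` then
`(log₂ n + 1) * (n + 1) ≤ (log₂ n + a + K) ^ K` (the room the witness `h' = 1` needs). [folklore] -/
theorem room_of_le_pow (n a k K : ℕ) (hk : 1 ≤ k) (hn : n ≤ (Nat.log 2 n + a + k) ^ k)
    (hK : k + 1 ≤ K) :
    (Nat.log 2 n + 1) * (n + 1) ≤ (Nat.log 2 n + a + K) ^ K := by
  set B := Nat.log 2 n + a + K with hB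
  have hB1 : 1 ≤ B := by omega
  -- `n + 1 ≤ B ^ k`
  have hk1 : n + 1 ≤ B ^ k := by
    have hstep : (Nat.log 2 n + a + k) ^ k + 1 ^ k ≤ (Nat.log 2 n + a + k + 1) ^ k :=
      pow_add_pow_le (Nat.zero_le _) (Nat.zero_le _) (by omega)
    rw [one_pow] at hstep
    calc n + 1 ≤ (Nat.log 2 n + a + k) ^ k + 1 := by omega
      _ ≤ (Nat.log 2 n + a + k + 1) ^ k := hstep
      _ ≤ B ^ k := Nat.pow_le_pow_left (by omega) _
  have hlog : Nat.log 2 n + 1 ≤ B := by omega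
  calc (Nat.log 2 n + 1) * (n + 1) ≤ B * B ^ k := Nat.mul_le_mul hlog hk1
    _ = B ^ (k + 1) := by rw [pow_succ, mul_comm]
    _ ≤ B ^ K := Nat.pow_le_pow_right hB1 hK

/-- Small `n` are free: if `(n+1)! ≤ K` and `1 ≤ K` then `(n+1)! ≤ 2 ^ ((log₂ n + a + K) ^ K)`.
[folklore] -/
theorem factorial_succ_le_two_pow_qp_of_le (n a K : ℕ) (hK : 1 ≤ K) (hsmall : (n + 1).factorial ≤ K) :
    (n + 1).factorial ≤ 2 ^ ((Nat.log 2 n + a + K) ^ K) := by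
  have h1 : K < 2 ^ K := Nat.lt_two_pow_self
  have h2 : K ≤ (Nat.log 2 n + a + K) ^ K :=
    (by omega : K ≤ Nat.log 2 n + a + K).trans (Nat.le_self_pow (by omega) _)
  exact hsmall.trans (h1.le.trans (Nat.pow_le_pow_right two_pos h2))

/-! ### ExpMultiplesHard ⇒ crux (witness `h' = 1`) -/

/-- **Weakly-exponential hardness of all monotone multiples of the permanent implies cofactor
degree reduction**, with the trivial witness `h' = 1`: if `n ≤ (log₂ n + log₂ L⁺(per_n·h) + k)^k`
for all large `n` and all nonzero `h`, then for `K = max (k+2) (n₀+1)!` the bound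
`2 ^ ((log₂ n + log₂ L⁺(per_n·h) + K) ^ K)` dominates `(n+1)! ≥ L⁺(per_n) = L⁺(per_n · 1)` for
every `n` (small `n` by the factorial term, large `n` by `room_of_le_pow`). [folklore] -/
theorem pcdr_of_expMultiplesHard
    (hexp : ∃ k n₀ : ℕ, ∀ n ≥ n₀, ∀ h : MvPolynomial (Fin n × Fin n) ℝ≥0, h ≠ 0 →
      n ≤ (Nat.log 2 n + Nat.log 2 (complexity (perPoly (Fin n) ℝ≥0 * h)) + k) ^ k) :
    PerCofactorDegreeReduction := by
  obtain ⟨k, n₀, hk⟩ := hexp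
  refine ⟨max (k + 2) (n₀ + 1).factorial, fun n h hh => ⟨1, one_ne_zero, by simp, ?_⟩⟩
  set K := max (k + 2) (n₀ + 1).factorial with hKdef
  have hK1 : 1 ≤ K := le_max_of_le_left (by omega)
  rw [mul_one]
  refine (complexity_perPoly_le_factorial_succ n).trans ?_
  by_cases hn : n₀ ≤ n
  · -- large `n`: the hardness hypothesis (with exponent raised to `k + 1 ≥ 1`) gives the room
    have h1 : n ≤ (Nat.log 2 n + Nat.log 2 (complexity (perPoly (Fin n) ℝ≥0 * h)) + (k + 1)) ^ (k + 1) :=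
      (hk n hn h hh).trans (qp_mono (Nat.le_succ k) (by omega))
    have hroom := room_of_le_pow n (Nat.log 2 (complexity (perPoly (Fin n) ℝ≥0 * h))) (k + 1) K
      (by omega) h1 (le_max_left _ _)
    exact (factorial_succ_le_two_pow n).trans (Nat.pow_le_pow_right two_pos hroom)
  · -- small `n`: `(n+1)! ≤ (n₀+1)! ≤ K`
    push Not at hn
    refine factorial_succ_le_two_pow_qp_of_le n _ K hK1 ?_
    exact (Nat.factorial_le (by omega)).trans (le_max_right _ _)

/-! ### crux ∧ LowDegreeExpHard ⇒ ExpMultiplesHard (the crux is a lifting statement) -/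

/-- Absorbing one quasi-polynomial into another:
`log₂ n + (log₂ n + a + k) ^ k + k₁ ≤ (log₂ n + a + (k + k₁ + 3)) ^ (k + 2)`. [folklore] -/
theorem qp_absorb_step (n a k k₁ : ℕ) :
    Nat.log 2 n + (Nat.log 2 n + a + k) ^ k + k₁ ≤ (Nat.log 2 n + a + (k + k₁ + 3)) ^ (k + 2) := by
  set E := Nat.log 2 n + a + (k + k₁ + 3) with hE
  have hE3 : 3 ≤ E := by omega
  have h1 : (Nat.log 2 n + a + k) ^ k ≤ E ^ k := Nat.pow_le_pow_left (by omega) _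
  have h2 : Nat.log 2 n + k₁ ≤ E := by omega
  -- `E ^ k + E ≤ … ≤ E ^ (k+2) = E ^ k * E * E`
  have hEk1 : 1 ≤ E ^ k := Nat.one_le_pow _ _ (by omega)
  have h3 : E ^ k + 2 * E ≤ E ^ (k + 2) := by
    have hpow : E ^ (k + 2) = E ^ k * E * E := by ring
    have hA : E ^ k ≤ E ^ k * E := Nat.le_mul_of_pos_right _ (by omega)
    have hB : E ≤ E ^ k * E := Nat.le_mul_of_pos_left _ hEk1
    have hC : E ^ k * E * 3 ≤ E ^ k * E * E := Nat.mul_le_mul_left _ hE3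
    rw [hpow]
    omega
  calc Nat.log 2 n + (Nat.log 2 n + a + k) ^ k + k₁
      ≤ E ^ k + E := by omega
    _ ≤ E ^ k + 2 * E := by omega
    _ ≤ E ^ (k + 2) := h3

/-- **Cofactor degree reduction LIFTS low-degree hardness to all degrees.**  If the crux holds with
exponent `k`, and every nonzero cofactor `h'` satisfies
`n ≤ (log₂ n + log₂ (max (deg h') (L⁺(per_n · h'))) + k₁) ^ k₁` for large `n` (multiples of low
cofactor degree are weakly-exponentially expensive), then every nonzero monotone multiple is
weakly-exponentially expensive: `n ≤ (log₂ n + log₂ L⁺(per_n · h) + K) ^ K` for large `n`,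
`K = (k + 2) * k₁ + k + k₁ + 3`.  Proof: apply the low-degree hypothesis to the crux's witness `h'`,
whose degree and cost are both `≤ 2 ^ ((log₂ n + log₂ L⁺(per_n · h) + k) ^ k)`. [folklore] -/
theorem expMultiplesHard_of_pcdr_of_lowDegreeExpHard
    (hC : PerCofactorDegreeReduction)
    (hlow : ∃ k₁ n₁ : ℕ, ∀ n ≥ n₁, ∀ h' : MvPolynomial (Fin n × Fin n) ℝ≥0, h' ≠ 0 →
      n ≤ (Nat.log 2 n +
        Nat.log 2 (max h'.totalDegree (complexity (perPoly (Fin n) ℝ≥0 * h'))) + k₁) ^ k₁) :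
    ∃ k n₀ : ℕ, ∀ n ≥ n₀, ∀ h : MvPolynomial (Fin n × Fin n) ℝ≥0, h ≠ 0 →
      n ≤ (Nat.log 2 n + Nat.log 2 (complexity (perPoly (Fin n) ℝ≥0 * h)) + k) ^ k := by
  obtain ⟨k, hk⟩ := hC
  obtain ⟨k₁, n₁, hk₁⟩ := hlow
  refine ⟨(k + 2) * k₁ + (k + k₁ + 3), n₁, fun n hn h hh => ?_⟩
  set s := complexity (perPoly (Fin n) ℝ≥0 * h) with hs
  set K₀ := k + k₁ + 3 with hK₀
  obtain ⟨h', hh', hdeg, hL⟩ := hk n h hh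
  have hmax : max h'.totalDegree (complexity (perPoly (Fin n) ℝ≥0 * h')) ≤
      2 ^ ((Nat.log 2 n + Nat.log 2 s + k) ^ k) := max_le hdeg hL
  have hlogmax : Nat.log 2 (max h'.totalDegree (complexity (perPoly (Fin n) ℝ≥0 * h'))) ≤
      (Nat.log 2 n + Nat.log 2 s + k) ^ k := by
    have := Nat.log_mono_right (b := 2) hmax
    rwa [Nat.log_pow one_lt_two] at this
  have h1 := hk₁ n hn h' hh'
  -- `n ≤ (log n + (log n + log s + k)^k + k₁)^k₁ ≤ (log n + log s + K₀)^((k+2) k₁) ≤ …`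
  have h2 : n ≤ (Nat.log 2 n + (Nat.log 2 n + Nat.log 2 s + k) ^ k + k₁) ^ k₁ :=
    h1.trans (Nat.pow_le_pow_left (by omega) _)
  have h3 : (Nat.log 2 n + (Nat.log 2 n + Nat.log 2 s + k) ^ k + k₁) ^ k₁ ≤
      (Nat.log 2 n + Nat.log 2 s + K₀) ^ ((k + 2) * k₁) := by
    rw [pow_mul]
    exact Nat.pow_le_pow_left (qp_absorb_step n (Nat.log 2 s) k k₁) _
  have h4 : (Nat.log 2 n + Nat.log 2 s + K₀) ^ ((k + 2) * k₁) ≤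
      (Nat.log 2 n + Nat.log 2 s + ((k + 2) * k₁ + K₀)) ^ ((k + 2) * k₁ + K₀) :=
    (Nat.pow_le_pow_left (by omega) _).trans (Nat.pow_le_pow_right (by omega) (by omega))
  exact h2.trans (h3.trans h4)

/-- **Granted weakly-exponential hardness of LOW-degree multiples, the crux is EQUIVALENT to
weakly-exponential hardness of ALL monotone multiples of the permanent** (window forms).
[folklore] -/
theorem pcdr_iff_expMultiplesHard_of_lowDegreeExpHard
    (hlow : ∃ k₁ n₁ : ℕ, ∀ n ≥ n₁, ∀ h' : MvPolynomial (Fin n × Fin n) ℝ≥0, h' ≠ 0 →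
      n ≤ (Nat.log 2 n +
        Nat.log 2 (max h'.totalDegree (complexity (perPoly (Fin n) ℝ≥0 * h'))) + k₁) ^ k₁) :
    PerCofactorDegreeReduction ↔
    ∃ k n₀ : ℕ, ∀ n ≥ n₀, ∀ h : MvPolynomial (Fin n × Fin n) ℝ≥0, h ≠ 0 →
      n ≤ (Nat.log 2 n + Nat.log 2 (complexity (perPoly (Fin n) ℝ≥0 * h)) + k) ^ k :=
  ⟨fun hC => expMultiplesHard_of_pcdr_of_lowDegreeExpHard hC hlow, pcdr_of_expMultiplesHard⟩

end Summit.ValiantsHypothesis.ValiantsHypothesis.Theorems.DivisionGap.PerCofactorDegreeReduction.LogicalPosition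

end
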